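import Mathlib.Topology.MetricSpace.ProperSpace.Lemmas
import Literature.Analysis.FluidPDE.CompressibleEulerProfileFarFieldLowerBound
import HarnessLib

/-!
# The density of the exact self-similar solution is bounded below on bounded sets, uniformly up
# to the blow-up time (theorems only)

Topic `Literature/Analysis/FluidPDE`; namespace `Literature.Analysis.FluidPDE.CaolaboraEtAl2025`.
Sequel of `CompressibleEulerProfileFarFieldLowerBound.lean` (`S(ζ) ≥ c ζ^{1−r}` for large `ζ`).
THEOREMS ONLY, no new facts (D-0026).

For the self-similar solution `σ(t,x) = r⁻¹(T−t)^{1/r−1} S(|x|(T−t)^{−1/r})` built on a profile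
of the vendored fact `BuckmasterCaolaboraGomezserrano2025_thm11_monatomic` (`S > 0`,
`1 < r < 2`), the rescaled sound speed — hence the density `ρ = (ασ)^{1/α}` — is bounded BELOW
by a positive constant on every bounded set `|x| ≤ L`, uniformly in `t ∈ [0, T)`
(`exactSolution_soundSpeed_lower`): near the core (`|y| ≤ ζ₀` in self-similar variables)
`σ ≥ r⁻¹(T−t)^{1/r−1} min S ≥ r⁻¹T^{1/r−1} min S`, and away from it the two powers of `T − t`
cancel exactly, `σ ≥ r⁻¹ c |x|^{1−r} ≥ r⁻¹ c L^{1−r}`. This is the lower half of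
"`ρ ≍ (T−t)^{−(1−1/r)/α}` near the origin, smooth elsewhere" in Thm 1.2 of
Cao-Labora–Gómez-Serrano–Shi–Staffilani, and gives hypothesis (4) (`ρ ≥ c_l (T−t)^{p_l}`, here with
`p_l = 0`) of the vendored rates statement on the self-similar region of the periodic solution of
their Remark 1.5. [cite: CaolaboraEtAl2025, Thm 1.2 p. 6, Rem 1.5 p. 7; §1.3 p. 5]
-/

noncomputable section

open Set Filter Topology Metric
open scoped ContDiff

namespace Literature.Analysis.FluidPDE

open Literature.MathematicalPhysics.KineticTheory (V3)

namespace CaolaboraEtAl2025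

section DensityLower

variable {r T : ℝ} {U S : ℝ → ℝ} {Sb : V3 → ℝ} {σ : ℝ → V3 → ℝ}

/-- **Uniform positive lower bound for the sound speed of the exact self-similar solution on
bounded sets.** For profiles as in the vendored fact (`S > 0`, `1 < r < 2`), every blow-up time
`T > 0` and every radius `L > 0` there is `c > 0` with `σ(t,x) ≥ c` for all `t ∈ [0,T)` and
`|x| ≤ L`. [cite: CaolaboraEtAl2025, Thm 1.2 p. 6 (`ρ ≍ (T−t)^{−(1−1/r)/α}` near the origin and
smooth elsewhere); §1.3 p. 5] -/
theorem exactSolution_soundSpeed_lower (hr1 : 1 < r) (hr2 : r < 2)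
    (hU : ContDiff ℝ ∞ fun y : V3 => (U ‖y‖ / ‖y‖) • y) (hS : ContDiff ℝ ∞ fun y : V3 => S ‖y‖)
    (hode : ∀ ζ : ℝ, 0 < ζ →
      (r - 1) * U ζ + (ζ + U ζ) * deriv U ζ + 1 / 3 * S ζ * deriv S ζ = 0 ∧
      (r - 1) * S ζ + (ζ + U ζ) * deriv S ζ + 1 / 3 * S ζ * (deriv U ζ + 2 * U ζ / ζ) = 0)
    (hSpos : ∀ ζ : ℝ, 0 ≤ ζ → 0 < S ζ)
    (hlimU : Tendsto (fun ζ => U ζ / ζ) atTop (𝓝 0))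
    (hlimS : Tendsto (fun ζ => S ζ / ζ) atTop (𝓝 0))
    (hSb : Sb = fun y : V3 => S ‖y‖)
    (hσ : ∀ t x, σ t x = (r⁻¹ * (T - t) ^ (1 / r - 1)) * Sb ((T - t) ^ (-1 / r) • x))
    (hT : 0 < T) {L : ℝ} (hL : 0 < L) :
    ∃ c : ℝ, 0 < c ∧ ∀ t ∈ Ico 0 T, ∀ x : V3, ‖x‖ ≤ L → c ≤ σ t x := by
  obtain ⟨ζ₀, c₁, hζ₀, hc₁, hlow⟩ := profile_soundSpeed_lower hr1 hr2 hU hS hode hSpos hlimU hlimS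
  have hr0 : 0 < r := by linarith
  -- the minimum of `S̄` on the closed ball of radius `ζ₀`
  obtain ⟨y₀, -, hmin⟩ := (isCompact_closedBall (0 : V3) ζ₀).exists_isMinOn
    ⟨0, mem_closedBall_self hζ₀.le⟩ hS.continuous.continuousOn
  set m₀ : ℝ := S ‖y₀‖ with hm₀
  have hm₀pos : 0 < m₀ := hSpos _ (norm_nonneg _)
  -- the constant
  set κ : ℝ := min (T ^ (1 / r - 1) * m₀) (c₁ * L ^ (1 - r)) with hκ
  have hκpos : 0 < κ := lt_min (mul_pos (Real.rpow_pos_of_pos hT _) hm₀pos)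
    (mul_pos hc₁ (Real.rpow_pos_of_pos hL _))
  refine ⟨r⁻¹ * κ, mul_pos (inv_pos.2 hr0) hκpos, fun t ht x hx => ?_⟩
  have hl : 0 < T - t := sub_pos.2 ht.2
  have hlT : T - t ≤ T := by linarith [ht.1]
  set l : ℝ := T - t with hl'
  set e : ℝ := l ^ (-1 / r) with he
  have he0 : 0 < e := Real.rpow_pos_of_pos hl _
  have hy : ‖e • x‖ = e * ‖x‖ := by rw [norm_smul, Real.norm_eq_abs, abs_of_pos he0]
  have hσ' : σ t x = r⁻¹ * l ^ (1 / r - 1) * S ‖e • x‖ := by rw [hσ t x, hSb]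
  rw [hσ', mul_assoc]
  refine mul_le_mul_of_nonneg_left ?_ (inv_pos.2 hr0).le
  have hlpow : 0 < l ^ (1 / r - 1) := Real.rpow_pos_of_pos hl _
  by_cases hcase : ‖e • x‖ ≤ ζ₀
  · -- near the core: `S ≥ m₀` and `l^{1/r-1} ≥ T^{1/r-1}`
    have h1 : m₀ ≤ S ‖e • x‖ := by
      have := hmin (show e • x ∈ closedBall (0 : V3) ζ₀ by simpa using hcase)
      simpa [hm₀] using this
    have h2 : T ^ (1 / r - 1) ≤ l ^ (1 / r - 1) :=
      Real.rpow_le_rpow_of_nonpos hl hlT (by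
        have : 1 / r < 1 := by rw [div_lt_one hr0]; exact hr1
        linarith)
    calc κ ≤ T ^ (1 / r - 1) * m₀ := min_le_left _ _
      _ ≤ l ^ (1 / r - 1) * S ‖e • x‖ := mul_le_mul h2 h1 hm₀pos.le hlpow.le
  · -- away from the core: the powers of `l` cancel
    push Not at hcase
    have hx0 : 0 < ‖x‖ := by
      by_contra h
      push Not at h
      have : ‖x‖ = 0 := le_antisymm h (norm_nonneg _)
      rw [hy, this, mul_zero] at hcase
      linarith
    have h1 : c₁ * ‖e • x‖ ^ (1 - r) ≤ S ‖e • x‖ := hlow _ hcase.le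
    have h2 : ‖e • x‖ ^ (1 - r) = l ^ (1 - 1 / r) * ‖x‖ ^ (1 - r) := by
      rw [hy, Real.mul_rpow he0.le (norm_nonneg _), he, ← Real.rpow_mul hl.le]
      congr 2
      field_simp
      ring
    have h3 : L ^ (1 - r) ≤ ‖x‖ ^ (1 - r) := Real.rpow_le_rpow_of_nonpos hx0 hx (by linarith)
    have h4 : l ^ (1 / r - 1) * (l ^ (1 - 1 / r) * ‖x‖ ^ (1 - r)) = ‖x‖ ^ (1 - r) := by
      rw [← mul_assoc, ← Real.rpow_add hl, show (1 / r - 1 + (1 - 1 / r) : ℝ) = 0 by ring,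
        Real.rpow_zero, one_mul]
    calc κ ≤ c₁ * L ^ (1 - r) := min_le_right _ _
      _ ≤ c₁ * ‖x‖ ^ (1 - r) := mul_le_mul_of_nonneg_left h3 hc₁.le
      _ = l ^ (1 / r - 1) * (c₁ * ‖e • x‖ ^ (1 - r)) := by rw [h2, mul_left_comm, h4]
      _ ≤ l ^ (1 / r - 1) * S ‖e • x‖ := mul_le_mul_of_nonneg_left h1 hlpow.le

end DensityLower

end CaolaboraEtAl2025

end Literature.Analysis.FluidPDE
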